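/-
Copyright (c) 2026 the pub-hodgecm-mathlib formalisation cell (harness21).  Prover seat hodgecm-mathlib-LH4-p07 (g3), req620 Track A «(D-RAM) FOUR-FRAME» squad
(heir LEAD F0P3a-plan lineage; dealer LH4-plan lineage; MS ROAD A, Stage B brick B7 (i) «CORE-HANGING STRATA — THE CRITERION» of LH4-p10 (g2)'s SPEC
`F0/P3c/LH4/LH4-p10/g2/SPEC-StageB.v1.LH4p10g2.md` §C B7 ∕ MEMO v2 §4 (H); B10 socket `stub_B7_H`).  2026-09-04.
-/
import Summits.HodgeConjecture.HodgeConjecture.Theorems.F0P3cDyRamDiagonalGluedTubeCriterion   -- ★ p855737 (LH4-p10, B5 (i)): `formCongr_hnf_diagonal`, `det_coe_hnf`, `det_formCongr_diagonal`, `isIntMatrix_of_fin_three`, `isDualisableLattice_latt_hnf_glued_imp`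
import HarnessLib

/-!
# Crux `H413`, MS ROAD A, STAGE B brick B7 (i): «CORE-HANGING STRATA `H(2ρ)` — THE DUALISABILITY CRITERION (R) AT `s = 0`»

Cell `hodgecm-mathlib` (D-0151), FLOOR 0, crux item H413 = `stmt-HodgeConjecture-24833`; lane `--supports stmt-HodgeConjecture-24833 --as helper` (count-neutral).  THEOREMS ONLY
(no `def`, no instance, no notation, no `sorry`, default heartbeats).
LH4-p10 (g2) MEMO v2 §3.1 ∕ §4 (H) (`F0/P3c/LH4/LH4-p10/g2/MEMO-stableLaw-finite.v2.LH4p10g2.md`): in the (S-fin) count of the stable four-frame law, the lattices of the CORE-HANGING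
stratum `H(2ρ)` (axis vector `(2ρ, 2ρ, 2ρ)`, «hanging off the core at height `ρ`», `q ≥ 3` only) are `M = latt V`, `V = (1 0 0; x ϖ^ρ 0; xζ + y″ ϖ^ρζ ϖ^{2ρ})` with `x, ζ, y″` AND
`y = xζ + y″` units (`ρ ≥ 1`) — the `s = 0` end of the glued family `G₁(2ρ, s)` of ★ B5 (i) (`Theorems/F0P3cDyRamDiagonalGluedTubeCriterion.lean`, which needs `s = 2t ≥ 2`).  THIS FILE:
such an `M` is DUALISABLE (self-dual for SOME `σ`-fixed non-degenerate diagonal form) **iff (R): `ζ·σ(y″)∕σ(x)` is congruent to a `σ`-fixed element modulo `𝔭^ρ`** — the same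
γ-free criterion as for the tubes, with NO further condition (MEMO §4 (H): «(C11) and the extra unit condition in (C12) reduce to `ȳ ≠ 0`», i.e. to the stratum's own unit letter
`|xζ + y″| = 1`).  Hypotheses as ★ B5 (i): `σ` an involution with `|σ·| = |·|`, `ϖ ≠ 0`, `|ϖ| < 1`, the WILD TRACE BOUND `|a + σ a| ≤ |ϖ|·|a|` (every ramified quadratic datum with
`d ≥ 2` under the dyadic fence; it contains `|2| ≤ |ϖ|`, used here at `a = 1`).
* `v_two_le_of_trace_bound` — `|2| ≤ |ϖ|` from the trace bound at `a = 1`.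
* `isDualisableLattice_latt_hnf_coreHanging_imp` — dualisable ⟹ (R): ★ B5 (i)'s `…_glued_imp` AT `t = 0`, verbatim (that direction never used `t ≥ 1`).
* `isDualisableLattice_latt_hnf_coreHanging_of` — (R) ⟹ dualisable, by ★ B5 (i)'s explicit form `D = (−D₁(Nx + wNy), π₀^{−ρ}, w·π₀^{−ρ})`, `w = −1∕(Nζ + f)`, `π₀ = ϖσϖ`; the two places
  where `t ≥ 1` was used are replaced by the two unit letters of the stratum: `Nζ + f` is a unit BECAUSE `σx·(Nζ + f) = ζσy − (ζσy″ − σx·f) ≡ ζσy (𝔭^ρ)` and `y` is a unit;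
  `|Nx + w·Ny| = 1` BECAUSE `Nx + wNy = w·(−f·Nx + Ny″ + Tr(σ(xζ)y″))`, `−f·Nx + Ny″ ≡ σy″·(y″ − xζ) = σy″·(y − 2xζ) (𝔭)` and `|2xζ| ≤ |ϖ| < 1 = |y|`.
* **`isDualisableLattice_latt_hnf_coreHanging_iff`** — the criterion.
HONEST LABEL.  Count-neutral; the census laws stay PROVER TARGETS until the MS assembly lands; `HC_CM` is proved only modulo the 7 printed citations (2 remaining named inputs:
hLiu418 = `stmt-HodgeConjecture-24832`, h413 = `stmt-HodgeConjecture-24833`) until rung 0 closes.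

## References
* [Jacobowitz1962] R. Jacobowitz, *Hermitian forms over local fields*, Amer. J. Math. 84 (1962), §4, §7 (Gram matrices, unimodular lattices, dual bases).
* [Kottwitz1986BaseChangeUnits] R. Kottwitz, *Base change for unit elements of Hecke algebras*, Compositio Math. 60 (1986), §1 pp. 240–241 (fixed-lattice counting).
* [Serre1980Trees] J.-P. Serre, *Trees*, Springer (1980), Ch. II §1.1 (lattices `g·𝒪^N`, Hermite normal form).
-/

set_option autoImplicit false

noncomputable section

namespace Summit.HodgeConjecture.HodgeConjecture.Cruxes.H413.F0P3cDyRamDiagonalCoreHangingCriterion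

open Matrix
open Literature.NumberTheory.Automorphic Literature.NumberTheory.Automorphic.HermitianLattice Literature.NumberTheory.Automorphic.UnitaryGroup
open Literature.NumberTheory.Automorphic.UnitaryLatticeTree
open Summit.HodgeConjecture.HodgeConjecture.Cruxes.H413.F0P3cDyRamDiagonalTorusDefs
open Summit.HodgeConjecture.HodgeConjecture.Cruxes.H413.F0P3cDyRamDiagonalGluedTubeCriterion
open scoped Valued WithZero Matrix MatrixGroups

variable {K : Type*} [Field K] [Valued K ℤᵐ⁰]

/-! ## §1  `|2| ≤ |ϖ|` under the wild trace bound -/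

/-- The wild trace bound `|a + σa| ≤ |ϖ|·|a|` at `a = 1` reads `|2| ≤ |ϖ|` (so the residue characteristic is `2` whenever `|ϖ| < 1`). [cite: Serre1980Trees, Ch. II §1.1] -/
theorem v_two_le_of_trace_bound {σ : K →+* K} {ϖ : K} (hTr : ∀ a : K, Valued.v (a + σ a) ≤ Valued.v ϖ * Valued.v a) :
    Valued.v (2 : K) ≤ Valued.v ϖ := by
  have h := hTr 1
  rwa [map_one, one_add_one_eq_two, map_one, mul_one] at h

/-! ## §2  Dualisable ⟹ (R) (★ B5 (i) at `t = 0`) -/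

/-- **DUALISABLE ⟹ (R) on the core-hanging stratum**: if `latt (1 0 0; x ϖ^ρ 0; xζ+y″ ϖ^ρζ ϖ^{2ρ})` (`|x| = 1`, `|ζ|, |y″| ≤ 1`) is self-dual for a `σ`-fixed non-degenerate diagonal
form, then `ζσ(y″) ≡ σ(x)·f (𝔭^ρ)` for some FIXED `f` — ★ `isDualisableLattice_latt_hnf_glued_imp` with `t = 0`. [cite: Jacobowitz1962, §7] [cite: Kottwitz1986BaseChangeUnits, §1 pp. 240–241] -/
theorem isDualisableLattice_latt_hnf_coreHanging_imp {σ : K →+* K} (hσ : ∀ a, σ (σ a) = a) (hvσ : ∀ a, Valued.v (σ a) = Valued.v a)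
    {ϖ : K} (hϖ0 : ϖ ≠ 0) (hϖ1 : Valued.v ϖ ≤ 1) (ρ : ℕ) {x ζ y'' : K} (hx : Valued.v x = 1) (hζ : Valued.v ζ ≤ 1) (hy'' : Valued.v y'' ≤ 1)
    (V : GL (Fin 3) K) (hV : (V : Matrix (Fin 3) (Fin 3) K) = !![1, 0, 0; x, ϖ ^ ρ, 0; x * ζ + y'', ϖ ^ ρ * ζ, ϖ ^ (2 * ρ)])
    (hM : IsDualisableLattice σ ϖ (latt (V : Matrix (Fin 3) (Fin 3) K))) :
    ∃ f : K, σ f = f ∧ Valued.v (ζ * σ y'' - σ x * f) ≤ Valued.v ϖ ^ ρ := by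
  have hV0 : (V : Matrix (Fin 3) (Fin 3) K) = !![1, 0, 0; x, ϖ ^ ρ, 0; x * ζ + y'', ϖ ^ ρ * ζ, ϖ ^ (2 * ρ + 2 * 0)] := by
    rw [Nat.mul_zero, Nat.add_zero]; exact hV
  have h := isDualisableLattice_latt_hnf_glued_imp hσ hvσ hϖ0 hϖ1 ρ 0 hx hζ hy'' V hV0 hM
  rwa [Nat.mul_zero, Nat.add_zero] at h

/-! ## §3  (R) ⟹ dualisable: the explicit form at `s = 0` -/

/-- **(R) ⟹ DUALISABLE on the core-hanging stratum**: if `ζσ(y″) ≡ σ(x)·f (𝔭^ρ)` for a FIXED `f` (`ρ ≥ 1`; `x, ζ, y″, y = xζ + y″` units), then with `w := −1∕(Nζ + f)` (a unit: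
`σx(Nζ + f) ≡ ζσy`), `π₀ := ϖσϖ` and the fixed diagonal form `D = (−D₁(Nx + w·Ny), π₀^{−ρ}, w·π₀^{−ρ})` the lattice `latt V` is self-dual: the Gram matrix is integral with unit
determinant (`|Nx + wNy| = 1` because `−fNx + Ny″ ≡ σy″(y − 2xζ)` and `|2| ≤ |ϖ|`). [cite: Jacobowitz1962, §7] [cite: Kottwitz1986BaseChangeUnits, §1 pp. 240–241] -/
theorem isDualisableLattice_latt_hnf_coreHanging_of {σ : K →+* K} (hσ : ∀ a, σ (σ a) = a) (hvσ : ∀ a, Valued.v (σ a) = Valued.v a)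
    {ϖ : K} (hϖ0 : ϖ ≠ 0) (hϖ1 : Valued.v ϖ < 1) (hTr : ∀ a : K, Valued.v (a + σ a) ≤ Valued.v ϖ * Valued.v a)
    (ρ : ℕ) (hρ : 1 ≤ ρ) {x ζ y'' : K} (hx : Valued.v x = 1) (hζ : Valued.v ζ = 1) (hy'' : Valued.v y'' = 1) (hy : Valued.v (x * ζ + y'') = 1)
    (V : GL (Fin 3) K) (hV : (V : Matrix (Fin 3) (Fin 3) K) = !![1, 0, 0; x, ϖ ^ ρ, 0; x * ζ + y'', ϖ ^ ρ * ζ, ϖ ^ (2 * ρ)])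
    {f : K} (hf : σ f = f) (hR : Valued.v (ζ * σ y'' - σ x * f) ≤ Valued.v ϖ ^ ρ) :
    IsDualisableLattice σ ϖ (latt (V : Matrix (Fin 3) (Fin 3) K)) := by
  set c : ℕ := 2 * ρ with hc
  have hvϖ : 0 < Valued.v ϖ := (Valuation.pos_iff _).2 hϖ0
  have hϖ1' : Valued.v ϖ ≤ 1 := hϖ1.le
  have hvϖc : Valued.v ϖ ^ c ≠ 0 := pow_ne_zero _ hvϖ.ne'
  have hϖρ1 : Valued.v ϖ ^ ρ < 1 := pow_lt_one₀ zero_le hϖ1 (by omega)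
  have h2 : Valued.v (2 : K) < 1 := (v_two_le_of_trace_bound hTr).trans_lt hϖ1
  -- `|f| = 1`
  have h1 : Valued.v (ζ * σ y'') = 1 := by rw [map_mul, hζ, hvσ, hy'', one_mul]
  have hRlt : Valued.v (ζ * σ y'' - σ x * f) < 1 := hR.trans_lt hϖρ1
  have hvxf : Valued.v (σ x * f) = 1 := by
    have e : σ x * f = ζ * σ y'' + -(ζ * σ y'' - σ x * f) := by ring
    rw [e, Valuation.map_add_eq_of_lt_left _ (by rwa [Valuation.map_neg, h1]), h1]
  have hvf : Valued.v f = 1 := by rw [map_mul, hvσ, hx, one_mul] at hvxf; exact hvxf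
  -- the unit `Nζ + f` (uses `|y| = 1`) and `w`
  set y : K := x * ζ + y'' with hydef
  set Nζ : K := ζ * σ ζ with hNζ
  have hvNζ : Valued.v Nζ = 1 := by rw [hNζ, map_mul, hvσ, hζ, one_mul]
  have hkey : σ x * (Nζ + f) = ζ * σ y + -(ζ * σ y'' - σ x * f) := by
    rw [hydef, hNζ, map_add, map_mul]; ring
  have hvζσy : Valued.v (ζ * σ y) = 1 := by rw [map_mul, hζ, hvσ, hy, one_mul]
  have hvNf : Valued.v (Nζ + f) = 1 := by
    have h' : Valued.v (σ x * (Nζ + f)) = 1 := by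
      rw [hkey, Valuation.map_add_eq_of_lt_left _ (by rwa [Valuation.map_neg, hvζσy]), hvζσy]
    rw [map_mul, hvσ, hx, one_mul] at h'; exact h'
  have hNf0 : Nζ + f ≠ 0 := fun h => by rw [h, map_zero] at hvNf; exact zero_ne_one hvNf
  set w : K := -(Nζ + f)⁻¹ with hw
  have hσNζ : σ Nζ = Nζ := by rw [hNζ, map_mul, hσ, mul_comm]
  have hσw : σ w = w := by rw [hw, map_neg, map_inv₀, map_add, hσNζ, hf]
  have hvw : Valued.v w = 1 := by rw [hw, Valuation.map_neg, map_inv₀, hvNf, inv_one]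
  have hw0 : w ≠ 0 := fun h => by rw [h, map_zero] at hvw; exact zero_ne_one hvw
  have hε : 1 + w * Nζ = -(w * f) := by rw [hw]; field_simp; ring
  -- the uniformiser of `F` and the form
  set π₀ : K := ϖ * σ ϖ with hπ₀
  have hσπ₀ : σ π₀ = π₀ := by rw [hπ₀, map_mul, hσ, mul_comm]
  have hvπ₀ : Valued.v π₀ = Valued.v ϖ ^ 2 := by rw [hπ₀, map_mul, hvσ, sq]
  have hσϖ0 : σ ϖ ≠ 0 := fun h => hϖ0 (by rw [← hσ ϖ, h, map_zero])
  have hπ₀0 : π₀ ≠ 0 := mul_ne_zero hϖ0 hσϖ0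
  set D₁ : K := (π₀ ^ ρ)⁻¹ with hD₁
  set D₂ : K := w * D₁ with hD₂
  set D₀ : K := -(D₁ * (σ x * x) + D₂ * (σ y * y)) with hD₀
  have hvD₁ : Valued.v D₁ = (Valued.v ϖ ^ c)⁻¹ := by
    rw [hD₁, map_inv₀, map_pow, hvπ₀, ← pow_mul, hc]
  have hvD₂ : Valued.v D₂ = (Valued.v ϖ ^ c)⁻¹ := by rw [hD₂, map_mul, hvw, one_mul, hvD₁]
  have hD₁0 : D₁ ≠ 0 := by rw [hD₁]; exact inv_ne_zero (pow_ne_zero _ hπ₀0)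
  have hD₂0 : D₂ ≠ 0 := mul_ne_zero hw0 hD₁0
  have hσD₁ : σ D₁ = D₁ := by rw [hD₁, map_inv₀, map_pow, hσπ₀]
  have hσD₂ : σ D₂ = D₂ := by rw [hD₂, map_mul, hσw, hσD₁]
  have hσD₀ : σ D₀ = D₀ := by
    rw [hD₀]; simp only [map_neg, map_add, map_mul, hσ, hσD₁, hσD₂]; ring
  have hvy : Valued.v y ≤ 1 := hy.le
  -- (k1) the glued entry: `D₁σx + D₂ζσy = D₁·w·(ζσy″ − σx·f)`
  have hk1 : D₁ * σ x + D₂ * ζ * σ y = D₁ * w * (ζ * σ y'' - σ x * f) := by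
    have e1 : D₁ * σ x + D₂ * ζ * σ y = D₁ * (σ x * (1 + w * Nζ) + w * ζ * σ y'') := by
      rw [hD₂, hydef, map_add, map_mul, hNζ]; ring
    rw [e1, hε]; ring
  have hvk1 : Valued.v (D₁ * σ x + D₂ * ζ * σ y) * Valued.v ϖ ^ ρ ≤ 1 := by
    rw [hk1, map_mul, map_mul, hvD₁, hvw, mul_one]
    have hAB : Valued.v (ζ * σ y'' - σ x * f) * Valued.v ϖ ^ ρ ≤ Valued.v ϖ ^ c :=
      calc Valued.v (ζ * σ y'' - σ x * f) * Valued.v ϖ ^ ρ ≤ Valued.v ϖ ^ ρ * Valued.v ϖ ^ ρ := mul_le_mul_left hR _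
        _ = Valued.v ϖ ^ c := by rw [← pow_add, hc]; congr 1; ring
    calc (Valued.v ϖ ^ c)⁻¹ * Valued.v (ζ * σ y'' - σ x * f) * Valued.v ϖ ^ ρ
        = (Valued.v ϖ ^ c)⁻¹ * (Valued.v (ζ * σ y'' - σ x * f) * Valued.v ϖ ^ ρ) := mul_assoc _ _ _
      _ ≤ (Valued.v ϖ ^ c)⁻¹ * Valued.v ϖ ^ c := mul_le_mul_right hAB _
      _ = 1 := inv_mul_cancel₀ hvϖc
  -- (k2) the second diagonal entry: `σ(ϖ^ρ)D₁ϖ^ρ + σ(ϖ^ρζ)D₂ϖ^ρζ = π₀^ρ·D₁·(1 + wNζ) = −π₀^ρ D₁ w f`, a unit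
  have hk2 : σ (ϖ ^ ρ) * D₁ * ϖ ^ ρ + σ (ϖ ^ ρ * ζ) * D₂ * (ϖ ^ ρ * ζ) = -(π₀ ^ ρ * D₁ * w * f) := by
    have e : σ (ϖ ^ ρ) * D₁ * ϖ ^ ρ + σ (ϖ ^ ρ * ζ) * D₂ * (ϖ ^ ρ * ζ) = π₀ ^ ρ * D₁ * (1 + w * Nζ) := by
      rw [hD₂, hNζ, hπ₀, map_mul, map_pow, mul_pow]; ring
    rw [e, hε]; ring
  have hvk2 : Valued.v (σ (ϖ ^ ρ) * D₁ * ϖ ^ ρ + σ (ϖ ^ ρ * ζ) * D₂ * (ϖ ^ ρ * ζ)) ≤ 1 := by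
    rw [hk2, Valuation.map_neg, map_mul Valued.v (π₀ ^ ρ * D₁ * w) f, map_mul Valued.v (π₀ ^ ρ * D₁) w, map_mul Valued.v (π₀ ^ ρ) D₁, map_pow, hvπ₀, hvD₁, hvw,
      hvf, mul_one, mul_one, ← pow_mul, ← hc, mul_inv_cancel₀ hvϖc]
  -- (k4) `|Nx + wNy| = 1`, whence `|D₀| = |ϖ|^{−2ρ}`
  have hk4 : σ x * x + w * (σ y * y) = w * (-(f * (σ x * x)) + σ y'' * y'') + w * (σ (x * ζ) * y'' + σ (σ (x * ζ) * y'')) := by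
    have e : σ y * y = (σ x * x) * Nζ + (σ (x * ζ) * y'' + σ (σ (x * ζ) * y'')) + σ y'' * y'' := by
      rw [hydef, hNζ]; simp only [map_add, map_mul, hσ]; ring
    rw [e, show σ x * x + w * (σ x * x * Nζ + (σ (x * ζ) * y'' + σ (σ (x * ζ) * y'')) + σ y'' * y'') =
      (1 + w * Nζ) * (σ x * x) + w * (σ y'' * y'') + w * (σ (x * ζ) * y'' + σ (σ (x * ζ) * y'')) by ring, hε]
    ring
  -- the main term `−f·Nx + Ny″ = σy″·(y − 2xζ) − x·(σx·f − ζσy″)` is a unit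
  have hvmain : Valued.v (-(f * (σ x * x)) + σ y'' * y'') = 1 := by
    have e : -(f * (σ x * x)) + σ y'' * y'' = σ y'' * (y - 2 * (x * ζ)) + x * (ζ * σ y'' - σ x * f) := by rw [hydef]; ring
    have hu : Valued.v (σ y'' * (y - 2 * (x * ζ))) = 1 := by
      rw [map_mul, hvσ, hy'', one_mul, sub_eq_add_neg,
        Valuation.map_add_eq_of_lt_left _ (by rw [Valuation.map_neg, map_mul, map_mul, hx, hζ, mul_one, mul_one, hy]; exact h2), hy]
    have hsmall : Valued.v (x * (ζ * σ y'' - σ x * f)) < Valued.v (σ y'' * (y - 2 * (x * ζ))) := by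
      rw [hu, map_mul, hx, one_mul]; exact hRlt
    rw [e, v_add_eq_of_lt hsmall, hu]
  have hvrest : Valued.v (w * (σ (x * ζ) * y'' + σ (σ (x * ζ) * y''))) < 1 := by
    rw [map_mul, hvw, one_mul]
    refine (hTr _).trans_lt ?_
    rw [map_mul, hvσ, map_mul, hx, hζ, one_mul, one_mul, hy'', mul_one]
    exact hϖ1
  have hvk4 : Valued.v (σ x * x + w * (σ y * y)) = 1 := by
    have hm : Valued.v (w * (-(f * (σ x * x)) + σ y'' * y'')) = 1 := by rw [map_mul, hvw, hvmain, one_mul]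
    rw [hk4, v_add_eq_of_lt (by rw [hm]; exact hvrest), hm]
  have hD₀eq : D₀ = -(D₁ * (σ x * x + w * (σ y * y))) := by rw [hD₀, hD₂]; ring
  have hvD₀ : Valued.v D₀ = (Valued.v ϖ ^ c)⁻¹ := by
    rw [hD₀eq, Valuation.map_neg, map_mul, hvD₁, hvk4, mul_one]
  have hD₀0 : D₀ ≠ 0 := fun h => by
    rw [h, map_zero] at hvD₀; exact (inv_ne_zero hvϖc) hvD₀.symm
  -- the diagonal form
  let D : Fin 3 → K := ![D₀, D₁, D₂]
  have hD0 : D 0 = D₀ := rfl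
  have hD1 : D 1 = D₁ := rfl
  have hD2 : D 2 = D₂ := rfl
  refine ⟨D, fun i => ?_, ?_⟩
  · fin_cases i
    · exact ⟨hσD₀, hD₀0⟩
    · exact ⟨hσD₁, hD₁0⟩
    · exact ⟨hσD₂, hD₂0⟩
  -- the Gram matrix and its integrality
  have hG := formCongr_hnf_diagonal σ D x y (ϖ ^ ρ * ζ) (ϖ ^ ρ) (ϖ ^ c) V (by rw [hV])
  rw [hD0, hD1, hD2] at hG
  have hG00 : D₀ + σ x * D₁ * x + σ y * D₂ * y = 0 := by rw [hD₀]; ring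
  have hvϖρ : Valued.v (ϖ ^ ρ) = Valued.v ϖ ^ ρ := map_pow _ _ _
  have hvσϖρ : Valued.v (σ (ϖ ^ ρ)) = Valued.v ϖ ^ ρ := by rw [hvσ, map_pow]
  have hvϖcK : Valued.v (ϖ ^ c) = Valued.v ϖ ^ c := map_pow _ _ _
  have hpowle : ∀ n : ℕ, Valued.v ϖ ^ n ≤ 1 := fun n => pow_le_one₀ zero_le hϖ1'
  have hGint : IsIntMatrix (formCongr σ V (Matrix.diagonal D)) := by
    rw [hG]
    refine isIntMatrix_of_fin_three ?_ ?_ ?_ ?_ ?_ ?_ ?_ ?_ ?_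
    · rw [hG00, map_zero]; exact zero_le
    · -- `G₀₁ = ϖ^ρ (D₁σx + D₂ζσy)`
      rw [show σ x * D₁ * ϖ ^ ρ + σ y * D₂ * (ϖ ^ ρ * ζ) = (D₁ * σ x + D₂ * ζ * σ y) * ϖ ^ ρ by ring, map_mul, hvϖρ]
      exact hvk1
    · rw [map_mul, map_mul, hvσ, hvD₂, hvϖcK, mul_assoc, inv_mul_cancel₀ hvϖc, mul_one]; exact hvy
    · -- `G₁₀ = σ(ϖ^ρ)·σ(D₁σx + D₂ζσy)`
      have e : σ (ϖ ^ ρ) * D₁ * x + σ (ϖ ^ ρ * ζ) * D₂ * y = σ (ϖ ^ ρ) * σ (D₁ * σ x + D₂ * ζ * σ y) := by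
        rw [map_add, map_mul, map_mul, map_mul, map_mul, hσ, hσ, hσD₁, hσD₂]; ring
      rw [e, map_mul, hvσϖρ, hvσ, mul_comm]; exact hvk1
    · exact hvk2
    · rw [map_mul Valued.v (σ (ϖ ^ ρ * ζ) * D₂) (ϖ ^ c), map_mul Valued.v (σ (ϖ ^ ρ * ζ)) D₂, hvσ, map_mul Valued.v (ϖ ^ ρ) ζ, hvϖρ, hζ, mul_one,
        hvD₂, hvϖcK, mul_assoc, inv_mul_cancel₀ hvϖc, mul_one]; exact hpowle ρ
    · rw [map_mul, map_mul, hvσ, hvϖcK, hvD₂, mul_inv_cancel₀ hvϖc, one_mul]; exact hvy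
    · rw [map_mul, map_mul, hvσ, hvϖcK, hvD₂, mul_inv_cancel₀ hvϖc, one_mul, map_mul, hvϖρ, hζ, mul_one]; exact hpowle ρ
    · rw [map_mul, map_mul, hvσ, hvϖcK, hvD₂, mul_inv_cancel₀ hvϖc, one_mul]; exact hpowle c
  -- the determinant
  have hdet : Valued.v (formCongr σ V (Matrix.diagonal D)).det = 1 := by
    rw [det_formCongr_diagonal, det_coe_hnf x y (ϖ ^ ρ * ζ) (ϖ ^ ρ) (ϖ ^ c) V (by rw [hV]), hD0, hD1, hD2]
    simp only [map_mul, map_pow, hvσ, hvD₀, hvD₁, hvD₂]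
    set A := Valued.v ϖ ^ ρ with hA
    set C := Valued.v ϖ ^ c with hC
    have hA0 : A ≠ 0 := pow_ne_zero _ hvϖ.ne'
    have hC0 : C ≠ 0 := hvϖc
    calc A * C * (C⁻¹ * C⁻¹ * C⁻¹) * (A * C) = (A * A * C⁻¹) * (C * C⁻¹) * (C * C⁻¹) := by ac_rfl
      _ = 1 := by
          rw [mul_inv_cancel₀ hC0, mul_one, mul_one, show A * A = C by rw [hA, hC, ← pow_add, hc]; congr 1; ring, mul_inv_cancel₀ hC0]
  have hinv : IsIntMatrix (ϖ • (formCongr σ V (Matrix.diagonal D))⁻¹) := fun i j => by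
    rw [Matrix.smul_apply, smul_eq_mul, map_mul]
    exact mul_le_one' hϖ1' (isIntMatrix_nonsing_inv_of_v_det_eq_one hGint hdet i j)
  exact (isVertexLattice_latt_iff_of_v σ hvσ hϖ0 (Matrix.diagonal D) 0 V).2 ⟨hGint, hinv, by rw [hdet, pow_zero]⟩

/-- **THE CRITERION (R) FOR THE CORE-HANGING STRATA** (MEMO v2 §4 (H), SPEC B7): `latt (1 0 0; x ϖ^ρ 0; xζ+y″ ϖ^ρζ ϖ^{2ρ})` with units `x, ζ, y″, xζ + y″`, `ρ ≥ 1`,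
is dualisable iff `ζσ(y″)∕σ(x)` is `σ`-fixed modulo `𝔭^ρ` — the `s = 0` end of ★ B5 (i) `isDualisableLattice_latt_hnf_glued_iff`, with no further condition.
[cite: Jacobowitz1962, §7] [cite: Kottwitz1986BaseChangeUnits, §1 pp. 240–241] -/
theorem isDualisableLattice_latt_hnf_coreHanging_iff {σ : K →+* K} (hσ : ∀ a, σ (σ a) = a) (hvσ : ∀ a, Valued.v (σ a) = Valued.v a)
    {ϖ : K} (hϖ0 : ϖ ≠ 0) (hϖ1 : Valued.v ϖ < 1) (hTr : ∀ a : K, Valued.v (a + σ a) ≤ Valued.v ϖ * Valued.v a)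
    (ρ : ℕ) (hρ : 1 ≤ ρ) {x ζ y'' : K} (hx : Valued.v x = 1) (hζ : Valued.v ζ = 1) (hy'' : Valued.v y'' = 1) (hy : Valued.v (x * ζ + y'') = 1)
    (V : GL (Fin 3) K) (hV : (V : Matrix (Fin 3) (Fin 3) K) = !![1, 0, 0; x, ϖ ^ ρ, 0; x * ζ + y'', ϖ ^ ρ * ζ, ϖ ^ (2 * ρ)]) :
    IsDualisableLattice σ ϖ (latt (V : Matrix (Fin 3) (Fin 3) K)) ↔ ∃ f : K, σ f = f ∧ Valued.v (ζ * σ y'' - σ x * f) ≤ Valued.v ϖ ^ ρ :=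
  ⟨isDualisableLattice_latt_hnf_coreHanging_imp hσ hvσ hϖ0 hϖ1.le ρ hx hζ.le hy''.le V hV,
    fun ⟨_, hf, hR⟩ => isDualisableLattice_latt_hnf_coreHanging_of hσ hvσ hϖ0 hϖ1 hTr ρ hρ hx hζ hy'' hy V hV hf hR⟩

end Summit.HodgeConjecture.HodgeConjecture.Cruxes.H413.F0P3cDyRamDiagonalCoreHangingCriterion

end
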